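import Mathlib.NumberTheory.EulerProduct.DirichletLSeries
import Mathlib.NumberTheory.SumPrimeReciprocals
import Mathlib.Analysis.SpecialFunctions.Log.Summable
import Mathlib.NumberTheory.LSeries.Dirichlet
import HarnessLib

/-!
# `|ζ(σ+it)| ≥ ζ(2σ)/ζ(σ)` for `σ > 1` (Titchmarsh, Theorem 8.7) from the Euler product

Trunk T-ANT (`NumberTheory/LFunctions`), family RH.  From Mathlib's Euler product
`riemannZeta_eulerProduct_hasProd` (`ζ(s) = ∏_p (1 − p^{−s})⁻¹`, `Re s > 1`) and
`|1 − p^{−s}| ≤ 1 + p^{−σ} = (1 − p^{−2σ})/(1 − p^{−σ})`: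

* `Literature.NumberTheory.LFunctions.hasSum_log_norm_of_hasProd` — `∏ fᵢ = L ≠ 0` (unconditionally), `fᵢ ≠ 0` ⟹
  `∑ log|fᵢ| = log|L|`;
* `Literature.NumberTheory.LFunctions.hasSum_neg_log_norm_one_sub_prime_cpow` — `∑_p −log|1 − p^{−s}| = log|ζ(s)|` (`Re s > 1`);
* `Literature.NumberTheory.LFunctions.norm_riemannZeta_ge_div` — **`ζ(2σ)/ζ(σ) ≤ |ζ(σ+it)|`** for `σ > 1`
  [Titchmarsh 1986, Thm 8.7, (8.7.1): `|1/ζ(s)| ≤ ζ(σ)/ζ(2σ)`]; the input "`ζ(s) ≥ ζ(2σ)/ζ(σ)` for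
  `Re s > 1`" of Lehman's and Trudgian's lower bound for `∫ log|ζ(σ+it)| dσ`
  [Trudgian 2011, (2.14)–(2.15)], and the mechanism behind the named fact
  `Literature.Barriers.RiemannHypothesis.Titchmarsh1986_thm8_7`
  (`Literature/Barriers/RiemannHypothesis/BohrDenseValues.lean`; discharged in its sibling
  `BohrDenseValuesProofs.lean`).

## References

* E. C. Titchmarsh, *The Theory of the Riemann Zeta-Function*, 2nd ed. (1986), Thm 8.7.
* T. S. Trudgian, *Improvements to Turing's method*, Math. Comp. 80 (2011), §2.2 (2.14)–(2.15).
-/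

noncomputable section

open Complex Filter Topology

namespace Literature.NumberTheory.LFunctions

/-- If `∏ᵢ fᵢ = L` unconditionally with `L ≠ 0` and all `fᵢ ≠ 0`, then `∑ᵢ log ‖fᵢ‖ = log ‖L‖`.
[folklore] -/
theorem hasSum_log_norm_of_hasProd {ι : Type*} {f : ι → ℂ} {L : ℂ} (hp : HasProd f L)
    (hL : L ≠ 0) (hf : ∀ i, f i ≠ 0) :
    HasSum (fun i ↦ Real.log ‖f i‖) (Real.log ‖L‖) := by
  have hcont : ContinuousAt (fun w : ℂ ↦ Real.log ‖w‖) L :=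
    (continuous_norm.continuousAt).log (norm_ne_zero_iff.2 hL)
  refine ((hcont.tendsto.comp hp).congr fun S ↦ ?_)
  simp only [Function.comp_apply]
  rw [norm_prod, Real.log_prod]
  exact fun i _ ↦ norm_ne_zero_iff.2 (hf i)

/-- `|p^{−s}| = p^{−σ} < 1` for a prime `p` and `Re s > 0`; in particular `1 − p^{−s} ≠ 0`.
[folklore] -/
theorem norm_prime_cpow_neg (p : Nat.Primes) (s : ℂ) :
    ‖(p : ℂ) ^ (-s)‖ = (p : ℝ) ^ (-s.re) := by
  rw [Complex.norm_natCast_cpow_of_pos p.prop.pos]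
  simp

/-- `p^{−σ} < 1` for a prime `p` and `σ > 0`. [folklore] -/
theorem prime_rpow_neg_lt_one (p : Nat.Primes) {σ : ℝ} (hσ : 0 < σ) : (p : ℝ) ^ (-σ) < 1 :=
  Real.rpow_lt_one_of_one_lt_of_neg (by exact_mod_cast p.prop.one_lt) (by linarith)

/-- `1 − p^{−s} ≠ 0` for `Re s > 0`. [folklore] -/
theorem one_sub_prime_cpow_ne_zero (p : Nat.Primes) {s : ℂ} (hs : 0 < s.re) :
    1 - (p : ℂ) ^ (-s) ≠ 0 := by
  intro h
  have : ‖(p : ℂ) ^ (-s)‖ = 1 := by rw [← sub_eq_zero.1 h, norm_one]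
  rw [norm_prime_cpow_neg] at this
  linarith [prime_rpow_neg_lt_one p hs]

/-- **`∑_p −log|1 − p^{−s}| = log|ζ(s)|`** for `Re s > 1` (logarithm of the modulus of the Euler
product). [folklore] -/
theorem hasSum_neg_log_norm_one_sub_prime_cpow {s : ℂ} (hs : 1 < s.re) :
    HasSum (fun p : Nat.Primes ↦ -Real.log ‖1 - (p : ℂ) ^ (-s)‖) (Real.log ‖riemannZeta s‖) := by
  have h := hasSum_log_norm_of_hasProd (riemannZeta_eulerProduct_hasProd hs)
    (riemannZeta_ne_zero_of_one_lt_re hs)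
    (fun p ↦ inv_ne_zero (one_sub_prime_cpow_ne_zero p (by linarith)))
  refine h.congr_fun fun p ↦ ?_
  rw [norm_inv, Real.log_inv]

/-- **Titchmarsh, Theorem 8.7:** `ζ(2σ)/ζ(σ) ≤ |ζ(σ + it)|` for `σ > 1` (`ζ(σ)`, `ζ(2σ)` written as
moduli of the real values). [cite: Titchmarsh1986, Thm. 8.7] -/
theorem norm_riemannZeta_ge_div {s : ℂ} (hs : 1 < s.re) :
    ‖riemannZeta ((2 * s.re : ℝ) : ℂ)‖ / ‖riemannZeta (s.re : ℂ)‖ ≤ ‖riemannZeta s‖ := by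
  set σ : ℝ := s.re with hσ
  have hσ1 : 1 < ((σ : ℂ)).re := by simp [hs]
  have h2σ : 1 < (((2 * σ : ℝ) : ℂ)).re := by simp; linarith
  have hS := hasSum_neg_log_norm_one_sub_prime_cpow hs
  have h1 := hasSum_neg_log_norm_one_sub_prime_cpow hσ1
  have h2 := hasSum_neg_log_norm_one_sub_prime_cpow h2σ
  -- real values of the norms on the real axis
  have e1 : ∀ p : Nat.Primes, ‖1 - (p : ℂ) ^ (-(σ : ℂ))‖ = 1 - (p : ℝ) ^ (-σ) := by
    intro p
    have : (p : ℂ) ^ (-(σ : ℂ)) = (((p : ℝ) ^ (-σ) : ℝ) : ℂ) := by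
      rw [Complex.ofReal_cpow (by positivity)]; push_cast; ring_nf
    rw [this, ← Complex.ofReal_one, ← Complex.ofReal_sub, Complex.norm_real, Real.norm_eq_abs,
      abs_of_pos (by linarith [prime_rpow_neg_lt_one p (by linarith : (0:ℝ) < σ)])]
  have e2 : ∀ p : Nat.Primes, ‖1 - (p : ℂ) ^ (-((2 * σ : ℝ) : ℂ))‖ = 1 - ((p : ℝ) ^ (-σ)) ^ 2 := by
    intro p
    have : (p : ℂ) ^ (-((2 * σ : ℝ) : ℂ)) = (((p : ℝ) ^ (-(2 * σ)) : ℝ) : ℂ) := by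
      rw [Complex.ofReal_cpow (by positivity)]; push_cast; ring_nf
    have hsq : (p : ℝ) ^ (-(2 * σ)) = ((p : ℝ) ^ (-σ)) ^ 2 := by
      rw [← Real.rpow_natCast, ← Real.rpow_mul (by positivity)]; ring_nf
    rw [this, hsq]
    have hx := prime_rpow_neg_lt_one p (by linarith : (0:ℝ) < σ)
    have hx0 : 0 ≤ (p : ℝ) ^ (-σ) := by positivity
    have e : (1 : ℂ) - ((((p : ℝ) ^ (-σ)) ^ 2 : ℝ) : ℂ) = ((1 - ((p : ℝ) ^ (-σ)) ^ 2 : ℝ) : ℂ) := by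
      push_cast; ring
    rw [e, Complex.norm_real, Real.norm_eq_abs, abs_of_pos]
    nlinarith
  -- termwise comparison
  have hle : ∀ p : Nat.Primes, -Real.log ‖1 - (p : ℂ) ^ (-((2 * σ : ℝ) : ℂ))‖ -
      -Real.log ‖1 - (p : ℂ) ^ (-(σ : ℂ))‖ ≤ -Real.log ‖1 - (p : ℂ) ^ (-s)‖ := by
    intro p
    set x : ℝ := (p : ℝ) ^ (-σ) with hx
    have hx1 : x < 1 := prime_rpow_neg_lt_one p (by linarith : (0:ℝ) < σ)
    have hx0 : 0 < x := Real.rpow_pos_of_pos (by exact_mod_cast p.prop.pos) _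
    rw [e1, e2]
    have hfac : 1 - x ^ 2 = (1 - x) * (1 + x) := by ring
    rw [hfac, Real.log_mul (by linarith) (by linarith)]
    have hns : ‖1 - (p : ℂ) ^ (-s)‖ ≤ 1 + x := by
      calc ‖1 - (p : ℂ) ^ (-s)‖ ≤ ‖(1 : ℂ)‖ + ‖(p : ℂ) ^ (-s)‖ := norm_sub_le _ _
        _ = 1 + x := by rw [norm_one, norm_prime_cpow_neg]
    have hpos : 0 < ‖1 - (p : ℂ) ^ (-s)‖ :=
      norm_pos_iff.2 (one_sub_prime_cpow_ne_zero p (by linarith))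
    have := Real.log_le_log hpos hns
    linarith
  have hsum := hasSum_le hle (h2.sub h1) hS
  -- exponentiate
  have hζs : 0 < ‖riemannZeta s‖ := norm_pos_iff.2 (riemannZeta_ne_zero_of_one_lt_re hs)
  have hζ1 : 0 < ‖riemannZeta (σ : ℂ)‖ := norm_pos_iff.2 (riemannZeta_ne_zero_of_one_lt_re hσ1)
  have hζ2 : 0 < ‖riemannZeta ((2 * σ : ℝ) : ℂ)‖ :=
    norm_pos_iff.2 (riemannZeta_ne_zero_of_one_lt_re h2σ)
  rw [← Real.log_le_log_iff (div_pos hζ2 hζ1) hζs, Real.log_div hζ2.ne' hζ1.ne']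
  exact hsum

/-- The reciprocal form **(8.7.1)**: `|1/ζ(s)| ≤ ζ(σ)/ζ(2σ)` for `σ = Re s > 1`.
[cite: Titchmarsh1986, Thm. 8.7 eq. (8.7.1)] -/
theorem norm_inv_riemannZeta_le_div {s : ℂ} (hs : 1 < s.re) :
    ‖(riemannZeta s)⁻¹‖ ≤ ‖riemannZeta (s.re : ℂ)‖ / ‖riemannZeta ((2 * s.re : ℝ) : ℂ)‖ := by
  have h := norm_riemannZeta_ge_div hs
  have hζs : 0 < ‖riemannZeta s‖ := norm_pos_iff.2 (riemannZeta_ne_zero_of_one_lt_re hs)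
  have hζ1 : 0 < ‖riemannZeta (s.re : ℂ)‖ :=
    norm_pos_iff.2 (riemannZeta_ne_zero_of_one_lt_re (by simp [hs]))
  have hζ2 : 0 < ‖riemannZeta ((2 * s.re : ℝ) : ℂ)‖ :=
    norm_pos_iff.2 (riemannZeta_ne_zero_of_one_lt_re (by simp; linarith))
  rw [norm_inv, inv_le_comm₀ hζs (div_pos hζ1 hζ2), inv_div]
  exact h

end Literature.NumberTheory.LFunctions
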